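import Literature.Analysis.FluidPDE.TaoBoundedTotalSpeed
import Literature.Analysis.FluidPDE.TaoDuhamelSpeedMajorant
import Literature.Analysis.FluidPDE.TaoDuhamelSpeedPointwise
import HarnessLib

/-!
# Tao (2011/2013), Prop. 9.1 (bounded total speed) — discharged

Sibling proof file of `TaoBoundedTotalSpeed.lean` / `TaoUnitViscosity.lean` (D-0014): it proves the
last unproved leaf of the tree's decomposition of Tao 2011, Prop. 9.1 (arXiv:1108.1165,
Prop. 52, p. 27: for a finite energy almost smooth solution,
`‖u‖_{L¹_t L^∞_x([0,T] × ℝ³)} ≲ E(u₀,f,T)^{1/2} T^{1/4} + E(u₀,f,T)`), namely the nonlinear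
Duhamel estimate `tao2011_duhamelNonlinearSpeed_unit`, and assembles the discharges

* `tao2011_duhamelNonlinearSpeed_unit_holds` — `∫₀ᵀ ‖u(t) − e^{tΔ}u(0)‖_{L^∞} dt ≤ K E` under the
  a priori bounds (9.4)–(9.5), with the absolute constant `K = 2π · 6S/(2π)⁴`, `S = schurConst`:
  the pointwise Fourier majorant of `TaoDuhamelSpeedPointwise.lean`
  (`‖u(t,x₀) − e^{tΔ}u(0)(x₀)‖ ≤ 2π M(t)`, tested Duhamel formula against the Leray-projected heat
  kernel) integrated in time by `TaoDuhamelSpeedMajorant.lean`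
  (`∫₀ᵀ M ≤ (6S/(2π)⁴) ∫₀ᵀ∫|∇u|²_F`, Tonelli, the `t`-integral of the heat symbol and the bilinear
  Fourier–Schur estimate of `TaoFourierSchur.lean`);
* `tao2011_boundedTotalSpeed_apriori_unit_holds` (+ the proved dispersive free term),
  `tao2011_boundedTotalSpeed_unit_holds` (+ Lemma 8.1, `tao_finite_energy_smooth_energy_bound_holds`),
  `tao2011_boundedTotalSpeed_holds` (every `ν > 0`, by the proved rescaling);
* the downstream assemblies with Prop. 9.1 no longer a hypothesis: Cor. 11.1 and Cor. 11.4 from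
  the single remaining §10 leaf `tao2011_enstrophyLocalisation_exterior_apriori_unit`
  (`tao2011_boundedEnstrophy_of_exterior_apriori_unit`,
  `tao_unconditional_uniqueness_of_exterior_apriori_unit`).

The proof of Prop. 9.1 obtained this way follows Tao's §9 in structure (Duhamel formula,
dispersive estimate for the free term, heat decay `× |ξ|` for `e^{(t−t')Δ}P∇`, interchange of the
`t`-integral, a Schur-test bilinear bound by `‖∇u‖²_{L²L²}`) but replaces the Littlewood–Paley /
paraproduct bookkeeping by the single Fourier–Lebesgue bilinear estimate
`∫ ‖ξ‖⁻¹|𝓕(fg)| ≲ ‖∇f‖₂‖∇g‖₂` (Schur's test for the homogeneous kernel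
`(‖ξ‖‖ξ−η‖‖η‖)⁻¹` on `ℝ³ × ℝ³`), and the Duhamel formula for the finite energy class by its tested
form against `P(G_ε(·−x₀)e)` (Lemma 4.1 (i) and Lemma 8.1 enter through `isLerayHopfOn_of_finiteEnergy`).

## Mathlib / tree search

`lean search 'duhamelNonlinearSpeed_unit_holds|boundedTotalSpeed_unit_holds|boundedTotalSpeed_holds'`:
nothing before this file. Used: `lintegral_lintegral_speedMajorant_le` (`TaoDuhamelSpeedMajorant`),
`enorm_sub_heatExtension_le_speedMajorant` (`TaoDuhamelSpeedPointwise`),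
`tao2011_boundedTotalSpeed_apriori_unit_of_duhamel`, `tao2011_boundedTotalSpeed_unit_of_apriori`,
`memLp_two_of_lintegral_le` (`TaoBoundedTotalSpeed`), `tao2011_boundedTotalSpeed_of_unit`
(`TaoUnitViscosity`), `tao_finite_energy_smooth_energy_bound_holds` (`NSFiniteEnergySmoothProofs`).
Mathlib: `Set.projIcc`, `continuous_projIcc`, `eLpNormEssSup_le_of_ae_enorm_bound`.

## References

* T. Tao, *Localisation and compactness properties of the Navier–Stokes global regularity
  problem*, Anal. PDE 6 (2013) 25–107 = arXiv:1108.1165 (`Tao2011`): Prop. 9.1 (arXiv Prop. 52,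
  p. 27) and its proof (§9, pp. 27–28), Lemma 8.1 (arXiv Lemma 44), Lemma 4.1 (i) (arXiv Lemma 25),
  footnote 3 (viscosity normalisation), Cor. 11.1 (arXiv Cor. 68), Cor. 11.4 (arXiv Cor. 71).
-/

noncomputable section

open MeasureTheory Set Function Filter Metric Real
open scoped ENNReal NNReal FourierTransform RealInnerProductSpace ContDiff Topology

namespace Literature.Analysis.FluidPDE

open UnboundedOperators

/-! ## A continuous extension of the solution in time -/

/-- A classical solution on the closed slab `[0, T] × ℝ³` has a jointly continuous extension to all
times agreeing with it on `[0, T]` (compose with the projection onto `[0, T]`). [folklore] -/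
theorem IsClassicalNSSolutionOn.exists_continuous_extension {T ν : ℝ} (hT : 0 ≤ T)
    {u f : ℝ → EuclideanSpace ℝ (Fin 3) → EuclideanSpace ℝ (Fin 3)}
    {p : ℝ → EuclideanSpace ℝ (Fin 3) → ℝ} (hsol : IsClassicalNSSolutionOn (Icc 0 T) ν f u p) :
    ∃ U : ℝ → EuclideanSpace ℝ (Fin 3) → EuclideanSpace ℝ (Fin 3),
      Continuous (uncurry U) ∧ ∀ τ ∈ Icc 0 T, U τ = u τ := by
  refine ⟨fun τ => u (projIcc 0 T hT τ), ?_, fun τ hτ => by simp only [projIcc_of_mem hT hτ]⟩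
  have hcont : ContinuousOn (uncurry u) (Icc 0 T ×ˢ univ) := hsol.smooth_velocity.continuousOn
  have hmap : Continuous fun q : ℝ × EuclideanSpace ℝ (Fin 3) => (((projIcc 0 T hT q.1 : ℝ)), q.2) :=
    (continuous_subtype_val.comp (continuous_projIcc.comp continuous_fst)).prodMk continuous_snd
  exact hcont.comp_continuous hmap fun q => mk_mem_prod (projIcc 0 T hT q.1).2 (mem_univ _)

/-! ## The nonlinear Duhamel estimate -/

/-- **Discharge of `tao2011_duhamelNonlinearSpeed_unit`** (Tao 2011, proof of Prop. 9.1, the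
nonlinear part (9.7): "It remains to show that
`‖∫₀ᵗ e^{(t−t')Δ} O(P∇(uu)(t')) dt'‖_{L¹_t L^∞_x} ≲ E₀`"). For a classical solution of the
unit-viscosity unforced system on `[0, T] × ℝ³` with `sup_t ∫|u(t)|² ≤ 2E` and `∫₀ᵀ∫|∇u|²_F ≤ E`,
`∫₀ᵀ ‖u(t) − e^{tΔ}u(0)‖_{L^∞} dt ≤ K E` with `K = 2π · 6S/(2π)⁴` (`S = schurConst`): pointwise
`‖u(t,x₀) − e^{tΔ}u(0)(x₀)‖ ≤ 2π M(t)` (`enorm_sub_heatExtension_le_speedMajorant`) and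
`∫₀ᵀ M ≤ (6S/(2π)⁴)∫₀ᵀ∫|∇u|²_F ≤ (6S/(2π)⁴) E` (`lintegral_lintegral_speedMajorant_le`). PROVED. [cite: Tao2011, Prop. 9.1 (proof, §9, (9.2) and (9.7))] -/
theorem tao2011_duhamelNonlinearSpeed_unit_holds : tao2011_duhamelNonlinearSpeed_unit := by
  set c : ℝ := 6 * schurConst / (2 * π) ^ 4 with hc
  have hc0 : 0 < c := by
    have := schurConst_pos
    positivity
  refine ⟨2 * π * c, by positivity, ?_⟩
  intro T hT u p hsol E hE hEt hD
  rw [ENNReal.ofReal_one, one_mul] at hD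
  have hfe : ∃ A : ℝ≥0∞, A < ⊤ ∧ ∀ t ∈ Icc 0 T, ∫⁻ x, ‖u t x‖ₑ ^ 2 ≤ A :=
    ⟨ENNReal.ofReal (2 * E), ENNReal.ofReal_lt_top, hEt⟩
  -- Step 1: the pointwise bound gives the `L^∞` bound for every `t ∈ (0, T)`
  have hLinf : ∀ t ∈ Ioo 0 T,
      eLpNorm (fun x => u t x - heatExtension (u 0) t x) ∞ volume ≤
        ENNReal.ofReal (2 * π) * ∫⁻ τ in Ioo 0 t, ∑ j, ∑ k,
          ∫⁻ ξ, ‖ξ‖ₑ * ENNReal.ofReal (heatSymbol (t - τ) ξ) *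
            ‖𝓕 (fun x => ((u τ x j * u τ x k : ℝ) : ℂ)) ξ‖ₑ := by
    intro t ht
    rw [eLpNorm_exponent_top]
    exact eLpNormEssSup_le_of_ae_enorm_bound (Eventually.of_forall fun x₀ =>
      enorm_sub_heatExtension_le_speedMajorant hT hsol hfe ⟨ht.1, ht.2.le⟩ x₀)
  -- Step 2: the time integral of the majorant, through the continuous extension `U`
  obtain ⟨U, hUc, hUeq⟩ := hsol.exists_continuous_extension hT.le
  have hUs : ∀ τ ∈ Ioo 0 T, ContDiff ℝ ∞ (U τ) := fun τ hτ => by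
    rw [hUeq τ (Ioo_subset_Icc_self hτ)]
    exact hsol.contDiff_velocity (Ioo_subset_Icc_self hτ)
  have hU2 : ∀ τ ∈ Ioo 0 T, MemLp (U τ) 2 volume := fun τ hτ => by
    rw [hUeq τ (Ioo_subset_Icc_self hτ)]
    exact memLp_two_of_lintegral_le (hsol.contDiff_velocity (Ioo_subset_Icc_self hτ)).continuous
      (hEt τ (Ioo_subset_Icc_self hτ))
  have hmaj : ∫⁻ t in Ioo 0 T, ∫⁻ τ in Ioo 0 t, ∑ j, ∑ k,
        ∫⁻ ξ, ‖ξ‖ₑ * ENNReal.ofReal (heatSymbol (t - τ) ξ) *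
          ‖𝓕 (fun x => ((u τ x j * u τ x k : ℝ) : ℂ)) ξ‖ₑ ≤
      ENNReal.ofReal c * ∫⁻ τ in Ioo 0 T, ∫⁻ x, ENNReal.ofReal (frobeniusNormSq (fderiv ℝ (u τ) x)) := by
    have h := lintegral_lintegral_speedMajorant_le hUc hUs hU2
    have hL : ∫⁻ t in Ioo 0 T, ∫⁻ τ in Ioo 0 t, ∑ j, ∑ k,
          ∫⁻ ξ, ‖ξ‖ₑ * ENNReal.ofReal (heatSymbol (t - τ) ξ) *
            ‖𝓕 (fun x => ((u τ x j * u τ x k : ℝ) : ℂ)) ξ‖ₑ =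
        ∫⁻ t in Ioo 0 T, ∫⁻ τ in Ioo 0 t, ∑ j, ∑ k,
          ∫⁻ ξ, ‖ξ‖ₑ * ENNReal.ofReal (heatSymbol (t - τ) ξ) *
            ‖𝓕 (fun x => ((U τ x j * U τ x k : ℝ) : ℂ)) ξ‖ₑ := by
      refine setLIntegral_congr_fun measurableSet_Ioo fun t ht => ?_
      refine setLIntegral_congr_fun measurableSet_Ioo fun τ hτ => ?_
      simp only
      rw [hUeq τ ⟨hτ.1.le, (hτ.2.trans ht.2).le⟩]
    have hR : ∫⁻ τ in Ioo 0 T, ∫⁻ x, ENNReal.ofReal (frobeniusNormSq (fderiv ℝ (U τ) x)) =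
        ∫⁻ τ in Ioo 0 T, ∫⁻ x, ENNReal.ofReal (frobeniusNormSq (fderiv ℝ (u τ) x)) := by
      refine setLIntegral_congr_fun measurableSet_Ioo fun τ hτ => ?_
      rw [hUeq τ (Ioo_subset_Icc_self hτ)]
    rw [hL, ← hR, hc]
    exact h
  -- Step 3: assemble
  calc ∫⁻ t in Ioo 0 T, eLpNorm (fun x => u t x - heatExtension (u 0) t x) ∞ volume
      ≤ ∫⁻ t in Ioo 0 T, ENNReal.ofReal (2 * π) * ∫⁻ τ in Ioo 0 t, ∑ j, ∑ k,
          ∫⁻ ξ, ‖ξ‖ₑ * ENNReal.ofReal (heatSymbol (t - τ) ξ) *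
            ‖𝓕 (fun x => ((u τ x j * u τ x k : ℝ) : ℂ)) ξ‖ₑ := setLIntegral_mono' measurableSet_Ioo hLinf
    _ = ENNReal.ofReal (2 * π) * ∫⁻ t in Ioo 0 T, ∫⁻ τ in Ioo 0 t, ∑ j, ∑ k,
          ∫⁻ ξ, ‖ξ‖ₑ * ENNReal.ofReal (heatSymbol (t - τ) ξ) *
            ‖𝓕 (fun x => ((u τ x j * u τ x k : ℝ) : ℂ)) ξ‖ₑ :=
        lintegral_const_mul' _ _ ENNReal.ofReal_ne_top
    _ ≤ ENNReal.ofReal (2 * π) * (ENNReal.ofReal c *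
          ∫⁻ τ in Ioo 0 T, ∫⁻ x, ENNReal.ofReal (frobeniusNormSq (fderiv ℝ (u τ) x))) :=
        mul_le_mul' le_rfl hmaj
    _ ≤ ENNReal.ofReal (2 * π) * (ENNReal.ofReal c * ENNReal.ofReal E) :=
        mul_le_mul' le_rfl (mul_le_mul' le_rfl hD)
    _ = ENNReal.ofReal (2 * π * c * E) := by
        rw [← ENNReal.ofReal_mul hc0.le, ← ENNReal.ofReal_mul (by positivity)]
        congr 1
        ring

/-! ## Prop. 9.1 -/

/-- **Discharge of `tao2011_boundedTotalSpeed_apriori_unit`** (Tao 2011, Prop. 9.1 in a priori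
form, `ν = 1`): from the nonlinear Duhamel estimate and the proved dispersive free term
(`tao2011_boundedTotalSpeed_apriori_unit_of_duhamel`). PROVED. [cite: Tao2011, Prop. 9.1 (proof, §9)] -/
theorem tao2011_boundedTotalSpeed_apriori_unit_holds : tao2011_boundedTotalSpeed_apriori_unit :=
  tao2011_boundedTotalSpeed_apriori_unit_of_duhamel tao2011_duhamelNonlinearSpeed_unit_holds

/-- **Discharge of `tao2011_boundedTotalSpeed_unit` — Tao 2011, Prop. 9.1 (Bounded total speed),
unit viscosity** (arXiv Prop. 52, p. 27): for a finite energy classical solution of the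
unit-viscosity unforced Navier–Stokes system on `[0, T] × ℝ³` and any `E ≥ ½‖u(0)‖²_{L²}`,
`∫₀ᵀ ‖u(t)‖_{L^∞} dt ≤ K(E^{1/2}T^{1/4} + E)` with an absolute constant `K`. From Lemma 8.1
(`tao_finite_energy_smooth_energy_bound_holds`) and the a priori form
(`tao2011_boundedTotalSpeed_unit_of_apriori`). PROVED. [cite: Tao2011, Prop. 9.1] -/
theorem tao2011_boundedTotalSpeed_unit_holds : tao2011_boundedTotalSpeed_unit :=
  tao2011_boundedTotalSpeed_unit_of_apriori tao_finite_energy_smooth_energy_bound_holds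
    tao2011_boundedTotalSpeed_apriori_unit_holds

/-- **Discharge of `tao2011_boundedTotalSpeed` — Tao 2011, Prop. 9.1 for every viscosity `ν > 0`**
(footnote 3: the rescaling `v(s, x) = ν⁻¹u(s/ν, x)`, proved in `TaoUnitViscosity.lean` as
`tao2011_boundedTotalSpeed_of_unit`). PROVED. [cite: Tao2011, Prop. 9.1 + footnote 3] -/
theorem tao2011_boundedTotalSpeed_holds : tao2011_boundedTotalSpeed :=
  tao2011_boundedTotalSpeed_of_unit tao2011_boundedTotalSpeed_unit_holds

/-! ## Downstream assemblies without Prop. 9.1 as a hypothesis -/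

/-- **Cor. 11.1 (bounded enstrophy, every `ν > 0`) from the single remaining §10 leaf** — the a
priori (annular/exterior) form of Thm. 10.1 at unit viscosity; Lemma 8.1 and Prop. 9.1 are now
theorems (`tao2011_boundedEnstrophy_of_duhamel_leaves`). [cite: Tao2011, Cor. 11.1] -/
theorem tao2011_boundedEnstrophy_of_exterior_apriori_unit
    (hA' : tao2011_enstrophyLocalisation_exterior_apriori_unit) : tao2011_boundedEnstrophy :=
  tao2011_boundedEnstrophy_of_duhamel_leaves tao_finite_energy_smooth_energy_bound_holds
    tao2011_duhamelNonlinearSpeed_unit_holds hA'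

/-- **Cor. 11.4 (`tao_unconditional_uniqueness`, every `ν > 0`), its velocity form and the
duplicate vendoring `tao_finite_energy_velocity_uniqueness`, from the single remaining §10 leaf**
(`tao_unconditional_uniqueness_of_duhamel_leaves` with Lemma 8.1 and Prop. 9.1 discharged). [cite: Tao2011, Cor. 11.4 (Remark 11.3)] -/
theorem tao_unconditional_uniqueness_of_exterior_apriori_unit
    (hA' : tao2011_enstrophyLocalisation_exterior_apriori_unit) :
    tao_unconditional_uniqueness ∧ tao_unconditional_uniqueness_velocity ∧
      tao_finite_energy_velocity_uniqueness :=
  tao_unconditional_uniqueness_of_duhamel_leaves tao_finite_energy_smooth_energy_bound_holds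
    tao2011_duhamelNonlinearSpeed_unit_holds hA'

end Literature.Analysis.FluidPDE

end
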